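import Mathlib.Analysis.Calculus.ImplicitContDiff
import Mathlib.Analysis.Normed.Ring.Units
import HarnessLib

/-!
# Smooth dependence of fixed points on parameters (uniform contraction principle, `Cⁿ` form)

Analysis/Calculus support file (everything proved).  If `T : E₁ × E₂ → E₂` is `Cⁿ` and `x = T (p, x)` is solved
by a branch `θ p` which is continuous in `p`, with `‖∂ₓT (p, θ p)‖ < 1`, then `θ` is `Cⁿ`: apply the implicit
function theorem to `Φ (p, x) := x − T (p, x)`, whose partial derivative `1 − ∂ₓT` is invertible by the Neumann
series (`Units.oneSub`), and identify `θ` with the implicit function by local uniqueness.  Continuity of the branch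
is automatic for uniform contractions (`continuousAt_fixedPoint_of_lipschitz`).  This is the "solution map is
`C^∞` in the parameters" step that Picard-iteration constructions (e.g. the solution operators of Mao–Oh–Tao 2023,
§3, printed with Lipschitz dependence only, Rem. 1.9) leave implicit.

* `contDiffAt_of_implicitZero'` — Banach-parameter version of `ImplicitZeroCurve.contDiffAt_of_implicitZero`;
* `continuousAt_fixedPoint_of_lipschitz` — fixed points of maps uniformly contracting in `x` and continuous in
  `p` depend continuously on `p`;
* `contDiffAt_fixedPoint` — and are `Cⁿ` in `p` when `T` is `Cⁿ` with `‖∂ₓT‖ < 1` at the fixed point.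

## References

* S.-N. Chow, J. K. Hale, *Methods of Bifurcation Theory* (1982), §2.2 (uniform contraction principle).
* Y. Mao, S.-J. Oh, Z. Tao, *Initial data gluing in the asymptotically flat regime via solution operators with
  prescribed support properties*, arXiv:2308.13031 (2023), §3 and Rem. 1.9. [`MaoOhTao2023`]
-/

noncomputable section

namespace Literature.Analysis.Calculus

open scoped Topology
open Set Filter Function Metric

variable {E₁ : Type*} [NormedAddCommGroup E₁] [NormedSpace ℝ E₁] [CompleteSpace E₁]
  {E₂ : Type*} [NormedAddCommGroup E₂] [NormedSpace ℝ E₂] [CompleteSpace E₂]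
  {F : Type*} [NormedAddCommGroup F] [NormedSpace ℝ F] [CompleteSpace F]

/-- **A continuous branch of non-degenerate zeros is as smooth as the equation** (Banach parameter space).  If
`Φ : E₁ × E₂ → F` is `Cⁿ` at `(p, θ p)` (`n ≠ 0`) with invertible partial derivative in the second variable, `θ`
is continuous at `p` and `Φ (p', θ p') = Φ (p, θ p)` for `p'` near `p`, then `θ` is `Cⁿ` at `p` (local uniqueness
of the implicit function, `ContDiffAt.eventually_apply_eq_iff_implicitFunction`). [folklore] -/
theorem contDiffAt_of_implicitZero' {Φ : E₁ × E₂ → F} {θ : E₁ → E₂} {p : E₁} {n : WithTop ℕ∞} (hn : n ≠ 0)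
    (hΦ : ContDiffAt ℝ n Φ (p, θ p))
    (hinv : (fderiv ℝ Φ (p, θ p) ∘L ContinuousLinearMap.inr ℝ E₁ E₂).IsInvertible)
    (hzero : ∀ᶠ p' in 𝓝 p, Φ (p', θ p') = Φ (p, θ p)) (hθ : ContinuousAt θ p) :
    ContDiffAt ℝ n θ p := by
  have hev := hΦ.eventually_apply_eq_iff_implicitFunction hn hinv
  have htend : Tendsto (fun p' ↦ (p', θ p')) (𝓝 p) (𝓝 (p, θ p)) :=
    (continuous_id.continuousAt.prodMk hθ :)
  have heq : θ =ᶠ[𝓝 p] hΦ.implicitFunction hn hinv := by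
    filter_upwards [htend.eventually hev, hzero] with p' h hz
    exact ((h.mp hz).symm :)
  exact (hΦ.contDiffAt_implicitFunction hn hinv).congr_of_eventuallyEq heq

omit [NormedSpace ℝ E₁] [CompleteSpace E₁] [NormedSpace ℝ E₂] [CompleteSpace E₂] in
/-- **Fixed points of uniform contractions depend continuously on the parameter.**  Suppose that for `p'` near
`p` the point `θ p'` is a fixed point of `T (p', ·)`, that `T (p', ·)` is `k`-Lipschitz (`k < 1`) on a set `B`
containing `θ p` and the `θ p'`, and that `p' ↦ T (p', θ p)` is continuous at `p`.  Then `θ` is continuous at `p`: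
`‖θ p' − θ p‖ ≤ k ‖θ p' − θ p‖ + ‖T (p', θ p) − T (p, θ p)‖`. [folklore] -/
theorem continuousAt_fixedPoint_of_lipschitz {T : E₁ × E₂ → E₂} {θ : E₁ → E₂} {p : E₁} {B : Set E₂}
    {k : NNReal} (hk : (k : ℝ) < 1) (hB : θ p ∈ B) (hmem : ∀ᶠ p' in 𝓝 p, θ p' ∈ B)
    (hlip : ∀ᶠ p' in 𝓝 p, LipschitzOnWith k (fun x ↦ T (p', x)) B)
    (hfix : ∀ᶠ p' in 𝓝 p, T (p', θ p') = θ p') (hcont : ContinuousAt (fun p' ↦ T (p', θ p)) p) :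
    ContinuousAt θ p := by
  rw [ContinuousAt, Metric.tendsto_nhds]
  intro ε hε
  have hk1 : 0 < 1 - (k : ℝ) := by linarith
  have hδ : ∀ᶠ p' in 𝓝 p, dist (T (p', θ p)) (T (p, θ p)) < (1 - k) * ε :=
    Metric.tendsto_nhds.1 hcont _ (mul_pos hk1 hε)
  filter_upwards [hmem, hlip, hfix, hδ] with p' hm hl hf hd
  have hp0 : T (p, θ p) = θ p := hfix.self_of_nhds
  have h1 : dist (θ p') (θ p) ≤ k * dist (θ p') (θ p) + dist (T (p', θ p)) (T (p, θ p)) := by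
    calc dist (θ p') (θ p) = dist (T (p', θ p')) (T (p, θ p)) := by rw [hf, hp0]
      _ ≤ dist (T (p', θ p')) (T (p', θ p)) + dist (T (p', θ p)) (T (p, θ p)) := dist_triangle _ _ _
      _ ≤ k * dist (θ p') (θ p) + dist (T (p', θ p)) (T (p, θ p)) := by
          gcongr
          exact hl.dist_le_mul _ hm _ hB
  have h2 : (1 - k) * dist (θ p') (θ p) < (1 - k) * ε := by nlinarith
  exact lt_of_mul_lt_mul_left h2 hk1.le

/-- **`Cⁿ` dependence of fixed points on parameters (uniform contraction principle).**  Let `T : E₁ × E₂ → E₂` be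
`Cⁿ` at `(p, θ p)` (`n ≠ 0`), where `θ p'` is a fixed point of `T (p', ·)` for `p'` near `p`, `θ` is continuous at
`p` (e.g. by `continuousAt_fixedPoint_of_lipschitz`), and `‖∂ₓT (p, θ p)‖ < 1`.  Then `θ` is `Cⁿ` at `p`: the
partial derivative `1 − ∂ₓT` of `Φ (p, x) := x − T (p, x)` is invertible (Neumann series, `Units.oneSub`), and
`contDiffAt_of_implicitZero'` applies. Chow–Hale 1982, §2.2. [folklore] -/
theorem contDiffAt_fixedPoint {T : E₁ × E₂ → E₂} {θ : E₁ → E₂} {p : E₁} {n : WithTop ℕ∞} (hn : n ≠ 0)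
    (hT : ContDiffAt ℝ n T (p, θ p))
    (hcontr : ‖fderiv ℝ T (p, θ p) ∘L ContinuousLinearMap.inr ℝ E₁ E₂‖ < 1)
    (hfix : ∀ᶠ p' in 𝓝 p, T (p', θ p') = θ p') (hθ : ContinuousAt θ p) :
    ContDiffAt ℝ n θ p := by
  set Φ : E₁ × E₂ → E₂ := fun q ↦ q.2 - T q with hΦdef
  have hΦ : ContDiffAt ℝ n Φ (p, θ p) := contDiffAt_snd.sub hT
  have hd : DifferentiableAt ℝ T (p, θ p) := (hT.hasStrictFDerivAt hn).hasFDerivAt.differentiableAt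
  have hderiv : fderiv ℝ Φ (p, θ p) = ContinuousLinearMap.snd ℝ E₁ E₂ - fderiv ℝ T (p, θ p) := by
    rw [show Φ = fun q ↦ Prod.snd q - T q from rfl, fderiv_fun_sub differentiableAt_snd hd, fderiv_snd]
  have hinv : (fderiv ℝ Φ (p, θ p) ∘L ContinuousLinearMap.inr ℝ E₁ E₂).IsInvertible := by
    rw [hderiv, ContinuousLinearMap.sub_comp, ContinuousLinearMap.snd_comp_inr]
    refine ⟨ContinuousLinearEquiv.ofUnit
      (Units.oneSub (fderiv ℝ T (p, θ p) ∘L ContinuousLinearMap.inr ℝ E₁ E₂) hcontr), ?_⟩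
    ext x
    rfl
  have hzero : ∀ᶠ p' in 𝓝 p, Φ (p', θ p') = Φ (p, θ p) := by
    have h0 : Φ (p, θ p) = 0 := by
      simp only [hΦdef]
      rw [hfix.self_of_nhds, sub_self]
    filter_upwards [hfix] with p' hp'
    rw [h0]
    simp only [hΦdef]
    rw [hp', sub_self]
  exact contDiffAt_of_implicitZero' hn hΦ hinv hzero hθ

end Literature.Analysis.Calculus

end
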